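import Literature.NumberTheory.LFunctions.CriticalLineTwoThirdsHilbertSchmidtProofs
import Literature.NumberTheory.LFunctions.CriticalLineTwoThirdsProportion
import HarnessLib

/-!
# RH-FREE — «nothing here bears on the truth of RH»: Alpöge–Furman 2026 (arXiv:2608.13637) Theorem A and its corollaries — the typed `ζ`-claims of `CriticalLineTwoThirds.lean` DISCHARGED (kernel consequences of the proved Proposition 4.2 and Theorem 5.7)

Topic `Literature/NumberTheory/LFunctions` (namespace `Literature.NumberTheory.LFunctions`).
Cell `rh-columns/lit`, unit `rh-lit-frontier-1` (gen 8). Source: **[AF26]** L. Alpöge, R. Furman,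
*More than two thirds of the zeros of the Riemann zeta function are simple and on the critical
line*, arXiv:2608.13637v2 (19 Aug 2026), UNREFEREED preprint (D-0012). This file has NO definition,
NO claim and NO `sorry`; every theorem is a one-line composition of theorems already in the tree.

## What this file records

The tree holds, as Lean theorems with the standard axioms only:
* `AlpogeFurman2026_trace_holds` ([AF26] Proposition 4.2 for the typed model,
  `CriticalLineTwoThirdsTraceProofs.lean`);
* `AlpogeFurman2026_hilbertSchmidt_holds` ([AF26] Theorem 5.7 for the typed model,
  `CriticalLineTwoThirdsHilbertSchmidtProofs.lean`);
* the §6 assembly "Proposition 4.2 ∧ Theorem 5.7 ⟹ Theorem A" (`CriticalLineTwoThirdsMatrixProofs.lean`,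
  with its specialisations `…_of_HS` in `CriticalLineTwoThirdsTraceProofs.lean` §§9–10).

Composing them discharges the seven typed `ζ`-claims of `CriticalLineTwoThirds.lean` ([AF26] Theorem A
(i)/(ii) in dyadic and cumulative form, the Montgomery–Taylor-window constants of the second sentence,
and the rate of Remark 6.1) and, through `CriticalLineTwoThirdsProportion.lean`, the named facts
`przz_bound` (`κ > 5/12`), `conrey_bound` (`κ ≥ 0.4088`) and `one_third_le_criticalLineProportion`
(`κ ≥ 1/3`) of `ZeroCounting.lean` for `κ = criticalLineProportion = liminf N₀(T)/N(T)`.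

## What the final statements depend on (for audit)

The discharged statements mention only the tree's standard objects: `zetaZeroCount` (`N(T)`, zeros with
`0 < γ ≤ T` counted with multiplicity), `simpleCriticalZeroCount` (`N₀ˢ(T)`), `distinctZeroCount`,
`criticalLineProportion` (`ZetaZeros.lean`, `ZeroCounting.lean`), Mathlib's `riemannZeta` through
`riemannZetaZeroOrder`, and the numerical constant `montgomeryTaylorInvConstant`. The typed model of
[AF26] §2 (`phi`, `gramMatrix`, `nearZeros`, …) is INTERNAL to the proof: its faithfulness to the printed
objects affects which argument was formalised, not the meaning of the statements below. `#print axioms`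
of every theorem here: `propext`, `Classical.choice`, `Quot.sound`.

STATUS NOTE (no endorsement). These are kernel-checked consequences, in this tree, of the formalisation
of [AF26]'s argument carried out in the `CriticalLineTwoThirds*` files (gens 0–8 of this unit); the
source is an unrefereed preprint and this file makes no statement about it beyond the citations.
Nothing here bears on the truth of RH.

## References
* [AlpogeFurman2026] as above: Theorem A and eq. (1.3)–(1.4) (p. 1), "the same holds for `(0,T)`"
  (p. 2), Remark 6.1 (p. 12), §1.3 (records, p. 2).
* [PrattRoblesZaharescuZeindler2020] K. Pratt, N. Robles, A. Zaharescu, D. Zeindler, *More than five-twelfths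
  of the zeros of `ζ` are on the critical line*, Res. Math. Sci. 7 (2020), Thm. 1.1 — the fact `przz_bound`.
* [Conrey1989] J. B. Conrey, *More than two fifths of the zeros of the Riemann zeta function are on the
  critical line*, J. reine angew. Math. 399 (1989), Thm. 1 — the fact `conrey_bound`.
* [Levinson1974] N. Levinson, *More than one third of zeros of Riemann's zeta-function are on σ = 1/2*,
  Adv. Math. 13 (1974) — the fact `one_third_le_criticalLineProportion`.
-/

noncomputable section

namespace Literature.NumberTheory.LFunctions

open AlpogeFurman2026

/-- **[AF26] Theorem A (i), dyadic form, DISCHARGED**: for every `ε > 0`, eventually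
`(2/3 − ε)(N(2T) − N(T)) ≤ N₀ˢ(2T) − N₀ˢ(T)`. [cite: AlpogeFurman2026, Theorem A (i) and eq. (1.3) (p. 1)] -/
theorem AlpogeFurman2026_simple_critical_dyadic_holds : AlpogeFurman2026_simple_critical_dyadic :=
  AlpogeFurman2026_simple_critical_dyadic_of_HS AlpogeFurman2026_hilbertSchmidt_holds

/-- **[AF26] Theorem A (ii), dyadic form, DISCHARGED**: for every `ε > 0`, eventually
`(5/6 − ε)(N(2T) − N(T)) ≤ N_d(2T) − N_d(T)`. [cite: AlpogeFurman2026, Theorem A (ii) and eq. (1.3) (p. 1)] -/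
theorem AlpogeFurman2026_distinct_dyadic_holds : AlpogeFurman2026_distinct_dyadic :=
  AlpogeFurman2026_distinct_dyadic_of_HS AlpogeFurman2026_hilbertSchmidt_holds

/-- **[AF26] Theorem A, second sentence (Montgomery–Taylor window), simple zeros, DISCHARGED**:
eventually `(2 − c_MT⁻¹ − ε)(N(2T) − N(T)) ≤ N₀ˢ(2T) − N₀ˢ(T)` (`2 − c_MT⁻¹ = 0.67250…`).
[cite: AlpogeFurman2026, Theorem A and eq. (1.4) (p. 1)] -/
theorem AlpogeFurman2026_simple_critical_MT_dyadic_holds : AlpogeFurman2026_simple_critical_MT_dyadic :=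
  AlpogeFurman2026_simple_critical_MT_dyadic_of_HS AlpogeFurman2026_hilbertSchmidt_holds

/-- **[AF26] Theorem A, second sentence (Montgomery–Taylor window), distinct zeros, DISCHARGED**:
eventually `((3 − c_MT⁻¹)/2 − ε)(N(2T) − N(T)) ≤ N_d(2T) − N_d(T)`.
[cite: AlpogeFurman2026, Theorem A and eq. (1.4) (p. 1)] -/
theorem AlpogeFurman2026_distinct_MT_dyadic_holds : AlpogeFurman2026_distinct_MT_dyadic :=
  AlpogeFurman2026_distinct_MT_dyadic_of_HS AlpogeFurman2026_hilbertSchmidt_holds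

/-- **[AF26] Theorem A (i), cumulative form, DISCHARGED**: for every `ε > 0` and all large `T`,
`(2/3 − ε) N(T) ≤ N₀ˢ(T)` — at least two thirds of the zeros of `ζ` with `0 < γ ≤ T`, counted with
multiplicity, are simple and on the critical line. [cite: AlpogeFurman2026, Theorem A (i) (p. 1) and p. 2 ("the same holds for `(0,T)`")] -/
theorem AlpogeFurman2026_simple_critical_holds : AlpogeFurman2026_simple_critical :=
  (AlpogeFurman2026_thmA_cumulative_of_HS AlpogeFurman2026_hilbertSchmidt_holds).1

/-- **[AF26] Theorem A (ii), cumulative form, DISCHARGED**: for every `ε > 0` and all large `T`,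
`(5/6 − ε) N(T) ≤ N_d(T)`. [cite: AlpogeFurman2026, Theorem A (ii) (p. 1) and p. 2] -/
theorem AlpogeFurman2026_distinct_holds : AlpogeFurman2026_distinct :=
  (AlpogeFurman2026_thmA_cumulative_of_HS AlpogeFurman2026_hilbertSchmidt_holds).2

/-- **[AF26] Remark 6.1 (rate), DISCHARGED**: there are `c, T₀` with
`(2/3 − c log log T/log T)(N(2T) − N(T)) ≤ N₀ˢ(2T) − N₀ˢ(T)` for `T ≥ T₀`.
[cite: AlpogeFurman2026, Remark 6.1 (p. 12)] -/
theorem AlpogeFurman2026_simple_critical_rate_holds : AlpogeFurman2026_simple_critical_rate :=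
  AlpogeFurman2026_simple_critical_rate_of_HS AlpogeFurman2026_hilbertSchmidt_holds

/-- **`κ ≥ 2/3`** for the critical-line proportion `κ = liminf N₀(T)/N(T)` of `ZeroCounting.lean`.
[cite: AlpogeFurman2026, Theorem A (p. 1), "a fortiori" sentence] -/
theorem two_thirds_le_criticalLineProportion : 2 / 3 ≤ criticalLineProportion :=
  AlpogeFurman2026_simple_critical_holds.two_thirds_le_criticalLineProportion

/-- **The fact `przz_bound` (`κ > 5/12`, Pratt–Robles–Zaharescu–Zeindler 2020, Thm. 1.1) DISCHARGED** —
here as a consequence of `κ ≥ 2/3`. [cite: PrattRoblesZaharescuZeindler2020, Thm. 1.1] [cite: AlpogeFurman2026, §1.3 (p. 2)] -/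
theorem przz_bound_holds : przz_bound :=
  przz_bound_of_AlpogeFurman2026 AlpogeFurman2026_simple_critical_holds

/-- **The facts `conrey_bound` (`κ ≥ 0.4088`, Conrey 1989) and `one_third_le_criticalLineProportion`
(`κ ≥ 1/3`, Levinson 1974) DISCHARGED** — here as consequences of `κ ≥ 2/3`.
[cite: Conrey1989, Thm. 1 (p. 4)] [cite: Levinson1974] [cite: AlpogeFurman2026, §1.3 (p. 2)] -/
theorem conrey_bound_holds : conrey_bound :=
  (AlpogeFurman2026_simple_critical_holds.conrey_levinson_selberg).1

/-- `κ ≥ 1/3` (Levinson 1974), DISCHARGED through [AF26]. [cite: Levinson1974] [cite: AlpogeFurman2026, §1.3 (p. 2)] -/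
theorem one_third_le_criticalLineProportion_holds : one_third_le_criticalLineProportion :=
  (AlpogeFurman2026_simple_critical_holds.conrey_levinson_selberg).2.1

/-! ## The discharged statements with every tree definition unfolded (for audit)

The same theorems restated in Mathlib primitives only — `riemannZeta`, `meromorphicOrderAt`, `finsum`,
`Set.ncard`, `Filter.liminf`/`atTop` — by definitional unfolding of `zetaZeroCount`, `zetaZeroCountRe`,
`zetaZeroBox`, `riemannZetaZeroOrder`, `simpleCriticalZeroCount`, `distinctZeroCount`,
`criticalZeroCount`, `criticalLineProportion` (`ZetaZeros.lean`, `ZeroCounting.lean`); each proof is the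
corresponding `…_holds` theorem accepted by `exact` up to unfolding, so the meaning of what the kernel
certifies can be read off here without opening the tree's definition files. -/

/-- **Theorem A (i), cumulative, fully unfolded**: for every `ε > 0` and all large `T`,
`(2/3 − ε) · Σ_{ζ(ρ)=0, 0≤Re ρ≤1, 0<Im ρ≤T} ord_ρ(ζ) ≤ #{ρ : ζ(ρ)=0, Re ρ = ½, 0<Im ρ≤T, ord_ρ(ζ) = 1}`
(`ord` = Mathlib's `meromorphicOrderAt`, read in `ℤ` by `untop₀`; the multiplicity sum read in `ℕ`).
[cite: AlpogeFurman2026, Theorem A (i) (p. 1) and p. 2] -/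
theorem AlpogeFurman2026_simple_critical_unfolded :
    ∀ ε : ℝ, 0 < ε → ∀ᶠ T : ℝ in Filter.atTop,
      (2 / 3 - ε) *
          ((∑ᶠ ρ ∈ {ρ : ℂ | riemannZeta ρ = 0 ∧ (0 : ℝ) ≤ ρ.re ∧ ρ.re ≤ 1 ∧ 0 < ρ.im ∧ ρ.im ≤ T},
              (meromorphicOrderAt riemannZeta ρ).untop₀).toNat : ℝ) ≤
        ({ρ ∈ {ρ : ℂ | riemannZeta ρ = 0 ∧ (1 / 2 : ℝ) ≤ ρ.re ∧ ρ.re ≤ 1 ∧ 0 < ρ.im ∧ ρ.im ≤ T} |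
            ρ.re = 1 / 2 ∧ (meromorphicOrderAt riemannZeta ρ).untop₀ = 1}.ncard : ℝ) :=
  AlpogeFurman2026_simple_critical_holds

/-- **Theorem A (ii), cumulative, fully unfolded**: for every `ε > 0` and all large `T`,
`(5/6 − ε) · Σ_{ζ(ρ)=0, 0≤Re ρ≤1, 0<Im ρ≤T} ord_ρ(ζ) ≤ #{ρ : ζ(ρ)=0, 0≤Re ρ≤1, 0<Im ρ≤T}`.
[cite: AlpogeFurman2026, Theorem A (ii) (p. 1) and p. 2] -/
theorem AlpogeFurman2026_distinct_unfolded :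
    ∀ ε : ℝ, 0 < ε → ∀ᶠ T : ℝ in Filter.atTop,
      (5 / 6 - ε) *
          ((∑ᶠ ρ ∈ {ρ : ℂ | riemannZeta ρ = 0 ∧ (0 : ℝ) ≤ ρ.re ∧ ρ.re ≤ 1 ∧ 0 < ρ.im ∧ ρ.im ≤ T},
              (meromorphicOrderAt riemannZeta ρ).untop₀).toNat : ℝ) ≤
        ({ρ : ℂ | riemannZeta ρ = 0 ∧ (0 : ℝ) ≤ ρ.re ∧ ρ.re ≤ 1 ∧ 0 < ρ.im ∧ ρ.im ≤ T}.ncard : ℝ) :=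
  AlpogeFurman2026_distinct_holds

/-- **`κ ≥ 2/3`, fully unfolded**: `2/3 ≤ liminf_{T→∞} N₀(T)/N(T)` with
`N₀(T) = Σ_{ζ(ρ)=0, Re ρ = ½, 0<Im ρ≤T} ord_ρ(ζ)` and `N(T) = Σ_{ζ(ρ)=0, 0≤Re ρ≤1, 0<Im ρ≤T} ord_ρ(ζ)`.
[cite: AlpogeFurman2026, Theorem A (p. 1), "a fortiori" sentence] -/
theorem two_thirds_le_criticalLineProportion_unfolded :
    (2 / 3 : ℝ) ≤ Filter.liminf (fun T : ℝ ↦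
      ((∑ᶠ ρ ∈ {ρ ∈ {ρ : ℂ | riemannZeta ρ = 0 ∧ (1 / 2 : ℝ) ≤ ρ.re ∧ ρ.re ≤ 1 ∧ 0 < ρ.im ∧ ρ.im ≤ T} |
          ρ.re = 1 / 2}, (meromorphicOrderAt riemannZeta ρ).untop₀).toNat : ℝ) /
        ((∑ᶠ ρ ∈ {ρ : ℂ | riemannZeta ρ = 0 ∧ (0 : ℝ) ≤ ρ.re ∧ ρ.re ≤ 1 ∧ 0 < ρ.im ∧ ρ.im ≤ T},
          (meromorphicOrderAt riemannZeta ρ).untop₀).toNat : ℝ)) Filter.atTop :=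
  two_thirds_le_criticalLineProportion

/-! ## Theorem A in elementary terms: absolute counts against `(T/2π) log T` (for audit; gen 9)

The statements below mention NO definition of this tree: only Mathlib's `riemannZeta`, `deriv`,
`Set.ncard`, `Real.log`, `Real.pi` and the order/filter vocabulary. They follow from the `…_holds`
theorems above, the Riemann–von Mangoldt formula in ratio form
(`RudnickSarnak.tendsto_zetaZeroCount_div_main`: `N(T)/((T/2π) log T) → 1`, proved in the tree from
`riemann_von_mangoldt_holds`) and two set identities: a zero `ρ` of `ζ` with `0 < Im ρ` is automatically
a non-trivial zero with `0 < Re ρ < 1` (`DiophantineGeometry.mem_zetaZeroBox_of_riemannZeta_eq_zero`), and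
for such `ρ` "multiplicity one" (`riemannZetaZeroOrder ρ = 1`, Mathlib's `meromorphicOrderAt`) is
`ζ′(ρ) ≠ 0` (`riemannZetaZeroOrder_eq_one_iff_deriv_ne_zero`). A lower bound on `Set.ncard` is robust
against the junk value `ncard = 0` of infinite sets. Read together: for large `T` the zeros of `ζ` with
`0 < Im ρ ≤ T` number at most `(1 + ε)(T/2π) log T` even when each is counted once, and at least
`(2/3 − ε)(T/2π) log T` of them lie on `Re s = ½` with `ζ′(ρ) ≠ 0`. -/

/-- The set counted by `simpleCriticalZeroCount T`, in Mathlib primitives: zeros of `ζ` on the critical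
line with `0 < Im ρ ≤ T` and `ζ′(ρ) ≠ 0`. [cite: Titchmarsh1986, §10.1, §10.29] -/
theorem AlpogeFurman2026.simpleCriticalZeros_eq_elementary (T : ℝ) :
    {ρ ∈ zetaZeroBox (1 / 2) T | ρ.re = 1 / 2 ∧ riemannZetaZeroOrder ρ = 1} =
      {ρ : ℂ | riemannZeta ρ = 0 ∧ ρ.re = 1 / 2 ∧ 0 < ρ.im ∧ ρ.im ≤ T ∧ deriv riemannZeta ρ ≠ 0} := by
  ext ρ
  simp only [Set.mem_setOf_eq]
  constructor
  · rintro ⟨hB, hre, h1⟩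
    have hnt := zetaZeroBox_subset_riemannZetaNontrivialZeros _ _ hB
    obtain ⟨h0, -, -, h3, h4⟩ := hB
    exact ⟨h0, hre, h3, h4, (riemannZetaZeroOrder_eq_one_iff_deriv_ne_zero hnt).1 h1⟩
  · rintro ⟨h0, hre, h3, h4, hd⟩
    have hB : ρ ∈ zetaZeroBox (1 / 2) T := ⟨h0, hre.symm.le, by rw [hre]; norm_num, h3, h4⟩
    exact ⟨hB, hre, (riemannZetaZeroOrder_eq_one_iff_deriv_ne_zero
      (zetaZeroBox_subset_riemannZetaNontrivialZeros _ _ hB)).2 hd⟩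

/-- The set counted by `distinctZeroCount T` (`zetaZeroBox 0 T`), in Mathlib primitives: ALL zeros of `ζ`
with `0 < Im ρ ≤ T` (such a zero has `0 < Re ρ < 1` automatically). [cite: Titchmarsh1986, §9.1] -/
theorem AlpogeFurman2026.zetaZeroBox_zero_eq_elementary (T : ℝ) :
    zetaZeroBox 0 T = {ρ : ℂ | riemannZeta ρ = 0 ∧ 0 < ρ.im ∧ ρ.im ≤ T} := by
  ext ρ
  constructor
  · rintro ⟨h0, -, -, h3, h4⟩
    exact ⟨h0, h3, h4⟩
  · rintro ⟨h0, h3, h4⟩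
    exact DiophantineGeometry.mem_zetaZeroBox_of_riemannZeta_eq_zero h0 h3 h4

/-- `N_d(T) ≤ N(T)`: counting the zeros of the box once is at most counting them with multiplicity
(each multiplicity is `≥ 1`). [cite: Titchmarsh1986, §9.1] -/
theorem AlpogeFurman2026.distinctZeroCount_le_zetaZeroCount (T : ℝ) :
    (distinctZeroCount T : ℝ) ≤ zetaZeroCount T := by
  have hB : (zetaZeroBox 0 T).Finite := zetaZeroBox_finite 0 T
  have h : ((distinctZeroCount T : ℕ) : ℤ) ≤ (zetaZeroCount T : ℤ) := by
    rw [zetaZeroCount_eq_finsum, finsum_mem_eq_finite_toFinset_sum _ hB, distinctZeroCount,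
      Set.ncard_eq_toFinset_card _ hB, Finset.card_eq_sum_ones]
    push_cast
    refine Finset.sum_le_sum fun ρ hρ ↦ ?_
    have := DiophantineGeometry.riemannZetaZeroOrder_pos_of_mem_zetaZeroBox
      ((Set.Finite.mem_toFinset hB).1 hρ)
    omega
  exact_mod_cast h

/-- Riemann–von Mangoldt as two-sided eventual bounds: for every `δ > 0`, eventually
`(1 − δ)(T/2π) log T ≤ N(T) ≤ (1 + δ)(T/2π) log T`. [cite: Titchmarsh1986, Thm. 9.4] -/
theorem AlpogeFurman2026.eventually_zetaZeroCount_near_main (δ : ℝ) (hδ : 0 < δ) :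
    ∀ᶠ T : ℝ in Filter.atTop,
      (1 - δ) * (T / (2 * Real.pi) * Real.log T) ≤ (zetaZeroCount T : ℝ) ∧
        (zetaZeroCount T : ℝ) ≤ (1 + δ) * (T / (2 * Real.pi) * Real.log T) := by
  have h := RudnickSarnak.tendsto_zetaZeroCount_div_main
  have hlo := h.eventually (eventually_gt_nhds (show (1 : ℝ) - δ < 1 by linarith))
  have hhi := h.eventually (eventually_lt_nhds (show (1 : ℝ) < 1 + δ by linarith))
  filter_upwards [hlo, hhi, Filter.eventually_gt_atTop (1 : ℝ)] with T h1 h2 hT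
  have hM : 0 < T / (2 * Real.pi) * Real.log T := by
    have := Real.log_pos hT
    positivity
  rw [lt_div_iff₀ hM] at h1
  rw [div_lt_iff₀ hM] at h2
  exact ⟨h1.le, h2.le⟩

/-- **[AF26] Theorem A (i), elementary absolute form**: for every `ε > 0` and all large `T`,
`#{ρ : ζ(ρ) = 0, Re ρ = ½, 0 < Im ρ ≤ T, ζ′(ρ) ≠ 0} ≥ (2/3 − ε) · (T/2π) log T`.
[cite: AlpogeFurman2026, Theorem A (i) (p. 1) and p. 2] [cite: Titchmarsh1986, Thm. 9.4] -/
theorem AlpogeFurman2026_simple_critical_elementary :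
    ∀ ε : ℝ, 0 < ε → ∀ᶠ T : ℝ in Filter.atTop,
      (2 / 3 - ε) * (T / (2 * Real.pi) * Real.log T) ≤
        ({ρ : ℂ | riemannZeta ρ = 0 ∧ ρ.re = 1 / 2 ∧ 0 < ρ.im ∧ ρ.im ≤ T ∧
            deriv riemannZeta ρ ≠ 0}.ncard : ℝ) := by
  intro ε hε
  filter_upwards [AlpogeFurman2026_simple_critical_holds (ε / 2) (by linarith),
    AlpogeFurman2026.eventually_zetaZeroCount_near_main (ε / 2) (by linarith),
    Filter.eventually_gt_atTop (1 : ℝ)] with T hA hN hT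
  rw [← AlpogeFurman2026.simpleCriticalZeros_eq_elementary]
  change _ ≤ (simpleCriticalZeroCount T : ℝ)
  have hM : 0 < T / (2 * Real.pi) * Real.log T := by
    have := Real.log_pos hT
    positivity
  rcases le_or_gt (2 / 3 - ε) 0 with hneg | hpos
  · exact (mul_nonpos_of_nonpos_of_nonneg hneg hM.le).trans (Nat.cast_nonneg _)
  · -- `(2/3 − ε) M ≤ (2/3 − ε/2)(1 − ε/2) M ≤ (2/3 − ε/2) N ≤ N⁽¹⁾`
    have h1 : (2 / 3 - ε) ≤ (2 / 3 - ε / 2) * (1 - ε / 2) := by nlinarith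
    calc (2 / 3 - ε) * (T / (2 * Real.pi) * Real.log T)
        ≤ (2 / 3 - ε / 2) * (1 - ε / 2) * (T / (2 * Real.pi) * Real.log T) :=
          mul_le_mul_of_nonneg_right h1 hM.le
      _ = (2 / 3 - ε / 2) * ((1 - ε / 2) * (T / (2 * Real.pi) * Real.log T)) := by ring
      _ ≤ (2 / 3 - ε / 2) * (zetaZeroCount T : ℝ) :=
          mul_le_mul_of_nonneg_left hN.1 (by linarith)
      _ ≤ simpleCriticalZeroCount T := hA

/-- **[AF26] Theorem A (ii), elementary absolute form, with the Riemann–von Mangoldt ceiling**: for every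
`ε > 0` and all large `T`,
`(5/6 − ε)(T/2π) log T ≤ #{ρ : ζ(ρ) = 0, 0 < Im ρ ≤ T} ≤ (1 + ε)(T/2π) log T` — the zeros up to height
`T`, each counted ONCE, are at least `5/6 − ε` and at most `1 + ε` times `(T/2π) log T` (the latter because
even with multiplicity they are `(1 + o(1))(T/2π) log T`). [cite: AlpogeFurman2026, Theorem A (ii) (p. 1) and p. 2] [cite: Titchmarsh1986, Thm. 9.4] -/
theorem AlpogeFurman2026_distinct_elementary :
    ∀ ε : ℝ, 0 < ε → ∀ᶠ T : ℝ in Filter.atTop,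
      (5 / 6 - ε) * (T / (2 * Real.pi) * Real.log T) ≤
          ({ρ : ℂ | riemannZeta ρ = 0 ∧ 0 < ρ.im ∧ ρ.im ≤ T}.ncard : ℝ) ∧
        ({ρ : ℂ | riemannZeta ρ = 0 ∧ 0 < ρ.im ∧ ρ.im ≤ T}.ncard : ℝ) ≤
          (1 + ε) * (T / (2 * Real.pi) * Real.log T) := by
  intro ε hε
  filter_upwards [AlpogeFurman2026_distinct_holds (ε / 2) (by linarith),
    AlpogeFurman2026.eventually_zetaZeroCount_near_main (ε / 2) (by linarith),
    AlpogeFurman2026.eventually_zetaZeroCount_near_main ε hε,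
    Filter.eventually_gt_atTop (1 : ℝ)] with T hA hN hN' hT
  rw [← AlpogeFurman2026.zetaZeroBox_zero_eq_elementary]
  change _ ≤ (distinctZeroCount T : ℝ) ∧ (distinctZeroCount T : ℝ) ≤ _
  have hM : 0 < T / (2 * Real.pi) * Real.log T := by
    have := Real.log_pos hT
    positivity
  refine ⟨?_, ?_⟩
  · rcases le_or_gt (5 / 6 - ε) 0 with hneg | hpos
    · exact (mul_nonpos_of_nonpos_of_nonneg hneg hM.le).trans (Nat.cast_nonneg _)
    · have h1 : (5 / 6 - ε) ≤ (5 / 6 - ε / 2) * (1 - ε / 2) := by nlinarith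
      calc (5 / 6 - ε) * (T / (2 * Real.pi) * Real.log T)
          ≤ (5 / 6 - ε / 2) * (1 - ε / 2) * (T / (2 * Real.pi) * Real.log T) :=
            mul_le_mul_of_nonneg_right h1 hM.le
        _ = (5 / 6 - ε / 2) * ((1 - ε / 2) * (T / (2 * Real.pi) * Real.log T)) := by ring
        _ ≤ (5 / 6 - ε / 2) * (zetaZeroCount T : ℝ) :=
            mul_le_mul_of_nonneg_left hN.1 (by linarith)
        _ ≤ distinctZeroCount T := hA
  · have hd := AlpogeFurman2026.distinctZeroCount_le_zetaZeroCount T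
    exact hd.trans hN'.2

/-- **The simple zeros on the line against ALL zeros counted once, elementary**: for every `ε > 0` and all
large `T`, `(2/3 − ε) · #{ρ : ζ(ρ) = 0, 0 < Im ρ ≤ T} ≤ #{ρ : ζ(ρ) = 0, Re ρ = ½, 0 < Im ρ ≤ T, ζ′(ρ) ≠ 0}`
(weaker than Theorem A (i), whose denominator counts multiplicity, but free of every multiplicity notion).
[cite: AlpogeFurman2026, Theorem A (i) (p. 1) and p. 2] -/
theorem AlpogeFurman2026_simple_critical_vs_distinct_elementary :
    ∀ ε : ℝ, 0 < ε → ∀ᶠ T : ℝ in Filter.atTop,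
      (2 / 3 - ε) * ({ρ : ℂ | riemannZeta ρ = 0 ∧ 0 < ρ.im ∧ ρ.im ≤ T}.ncard : ℝ) ≤
        ({ρ : ℂ | riemannZeta ρ = 0 ∧ ρ.re = 1 / 2 ∧ 0 < ρ.im ∧ ρ.im ≤ T ∧
            deriv riemannZeta ρ ≠ 0}.ncard : ℝ) := by
  intro ε hε
  filter_upwards [AlpogeFurman2026_simple_critical_holds ε hε] with T hA
  rw [← AlpogeFurman2026.simpleCriticalZeros_eq_elementary, ← AlpogeFurman2026.zetaZeroBox_zero_eq_elementary]
  change _ * (distinctZeroCount T : ℝ) ≤ (simpleCriticalZeroCount T : ℝ)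
  have hd := AlpogeFurman2026.distinctZeroCount_le_zetaZeroCount T
  rcases le_or_gt (2 / 3 - ε) 0 with hneg | hpos
  · exact (mul_nonpos_of_nonpos_of_nonneg hneg (Nat.cast_nonneg _)).trans (Nat.cast_nonneg _)
  · exact (mul_le_mul_of_nonneg_left hd hpos.le).trans hA

end Literature.NumberTheory.LFunctions

end
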